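import Summits.HodgeConjecture.HodgeConjecture.Theorems.F0P3ArchBlockClassOfArchIsotypy       -- (n1) FILE B (A-p14 (g26)): `archLift`, intertwiners, `hasToken_…`, `isUnitaryGlobalization_clInfChoiceU_of_archIsotypy`
import Summits.HodgeConjecture.HodgeConjecture.Theorems.F0P3ArchIsotypyOfIrreducibleCore      -- ★ B5b (F0P3-p01 (g4)): `archIsotypy_of_core'`, `core_le_comap_archRepK`
import HarnessLib

/-!
# F1a (`ArchIsotypy` at the CM frame) FROM ONE ADMISSIBLE ARCHIMEDEAN BLOCK — and L-iso with NO letter antecedent (ROAD «TF», J2, (n1)-junction; A-p14 (g26), FILE B′)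

Cell `hodgecm-mathlib`, programme P3 «U3-mult», ROAD «TF».  ★ `F0P3ArchIsotypyOfIrreducibleCore.archIsotypy_of_core'` (F0P3-p01 (g4)) proves the letter F1a
★ `DiscreteAutomorphicRep.ArchIsotypy` BY NAME for a discrete automorphic `P` from ONE closed `P|_G`-invariant subspace whose Harish-Chandra core
(`archModule ⊓ W`) is an irreducible admissible `(𝔤, K)`-module, using only `P.irreducible` (translate detection).  ★ FILE A2
`isIrreducibleGK_harishChandra_of_isAdmissibleGK` (A-p14 (g26)) proves that the Harish-Chandra module of a topologically irreducible unitary representation of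
`U(2,1)` with `K∞`-ADMISSIBLE Harish-Chandra module is irreducible.  THIS FILE joins them:

* §1 `blockCM W` — a closed `G′_∞`-block `W ≤ P.space` (a `ClosedSubrep` of `R|_{G′_∞}` contained in `P`) read as a closed `P.archRepCM`-invariant subspace of
  `P.space` (★ FILE B `archToAdelic_archLift`: the CM section acts through `G′_∞`); its core `archModuleCM ⊓ W` is identified with `H_K^∞(σbar)` (for any descent
  `σbar` of `W` along `archProjUForm`) by the two ★ `harishChandraMap`s of FILE B (inclusion `Ψ`, orthogonal projection `Φ`): `Φ ∘ Ψ = id`, `Ψ ∘ Φ = id` on the core.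
* §2 **`archIsotypy_of_isAdmissibleGK_block`** — if `W ≠ 0` is topologically irreducible (under `G′_∞`) and `H_K^∞(σbar)` is `K∞`-admissible, then
  **`P.ArchIsotypy U(2,1) (cmArchSectionUForm L ι H T hT)`** — F1a for `P`, with NO letter: the core is irreducible (transport of ★ FILE A2 along `Ψ`, `Φ`) and
  admissible (injective `K`-map `Φ` into `H_K^∞(σbar)`), so ★ `archIsotypy_of_core'` applies.
* §3 **`isUnitaryGlobalization_clInfChoiceU_of_isAdmissibleGK`** — FILE B's head with its F1a antecedent DISCHARGED by §2 (same `W`): every closed topologically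
  irreducible `G′_∞`-block `W ≤ P.space` with `K∞`-admissible Harish-Chandra module is, under any descent `σbar`, a unitary globalization of `clInfChoiceU … dflt P`;
  **`liso_of_isAdmissibleGK`** — the `hiso` binder of ★ p839537 at `rep c` with the SINGLE added antecedent `IsAdmissibleGK (harishChandraRepK U(2,1) σbar)` (and
  `cptTriv₀ c` dropped): **L-iso♭ holds with no letter**.

CONSEQUENCE (the desk's count): in the closer's block (H) the structure letter H3 reduces to H3-core + L-adm read at `K∞` (FILE C); neither L-iso nor F1a is a
letter there.  One `def` with body (`blockCM`, a re-typing), theorems otherwise; no instance, no notation, no named fact, no `sorry`.  NON-CLAIMS: nothing without the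
admissibility antecedent (L-iso verbatim ⊇ Harish-Chandra admissibility, named fact ★ `isAdmissibleGK_of_irreducible_unitary`).  HONEST LABEL: HC_CM is proved only
modulo the 2 remaining named inputs (hLiu418, h413) until rung 0 closes.

## References
* D. Flath, *Decomposition of representations into tensor products*, Corvallis 1979, part 1, Thm. 3 and Thm. 4 [FlathCorvallis1979].
* J. Dixmier, *C\*-algebras* (1977), §13.1.2, §13.1.8 [Dixmier1977].
* Harish-Chandra, *Representations of a semisimple Lie group on a Banach space I*, Trans. AMS 75 (1953), §9 Thms. 4–6, Thm. 8 [HarishChandra1953].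
* A. Borel, H. Jacquet, *Automorphic forms and automorphic representations*, Corvallis 1979, part 1, §4.3 and §4.6 [BorelJacquetCorvallis1979].
* A. W. Knapp, D. A. Vogan, *Cohomological Induction and Unitary Representations* (1995), §I.3–I.4 [KnappVogan1995].
-/

-- Mathlib idiom (as in ★ `GKModules`): commutator bracket, needed to MENTION `harishChandraRepLie` ∕ `GKIrrClass (uFormGroup …)`.
attribute [local instance 100] LieRing.ofAssociativeRing

set_option autoImplicit false
-- the mandated namespace repeats `HodgeConjecture.HodgeConjecture`, as in every `Theorems/*.lean` of this sub-problem
set_option linter.dupNamespace false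

noncomputable section

open MeasureTheory Measure NumberField Topology
open Literature.NumberTheory.Automorphic Literature.NumberTheory.Automorphic.UnitaryGroup
open Literature.NumberTheory.Automorphic.UnitaryGroup.CotangentForms
open Literature.RepresentationTheory Literature.RepresentationTheory.KonnoKonno2007 Literature.RepresentationTheory.KonnoKonno2007.RealDualPair
open Literature.RepresentationTheory.BorelWallach2000
open scoped Matrix InnerProductSpace

namespace Summit.HodgeConjecture.HodgeConjecture.Cruxes.H413.F0P3ArchIsotypyOfAdmissibleBlock

open Summit.HodgeConjecture.HodgeConjecture.Cruxes.H413.F0P3InnerFormClassification (HasToken Cinf Gp)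
open Summit.HodgeConjecture.HodgeConjecture.Cruxes.H413.F0P3ClassTokensOfRecord (Cls rep)
open Summit.HodgeConjecture.HodgeConjecture.Cruxes.H413.F0P3UnitaryLocOfRecord (clInfChoiceU)
open Summit.HodgeConjecture.HodgeConjecture.Cruxes.H413.F0P3ArchTraceOfRealisation (isUnitary_of_descend isStronglyContinuous_of_descend)
open Summit.HodgeConjecture.HodgeConjecture.Cruxes.H413.F0P3UFormExpGeneration (subgroup_eq_top_of_forall_expMem_mem_uForm)
open Summit.HodgeConjecture.HodgeConjecture.Cruxes.H413.F0P3ArchIsotypyOfIrreducibleCore (archIsotypy_of_core' core_le_comap_archRepK)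
open Summit.HodgeConjecture.HodgeConjecture.Cruxes.H413.F0P3ArchBlockClassOfArchIsotypy
open ContRepresentation (ClosedSubrep)

variable {L : Type} [Field L] [NumberField L] [IsCMField L] {ι : L →+* ℂ} {H : Matrix (Fin 3) (Fin 3) L} {T : GL (Fin 3) ℂ}
  {hT : (T : Matrix (Fin 3) (Fin 3) ℂ)ᴴ * H.map ι * (T : Matrix (Fin 3) (Fin 3) ℂ) = Literature.Geometry.ComplexHyperbolic.BallModel.J}
  {μ : Measure (Gp L H).automorphicQuotient} [(Gp L H).IsAutomorphicMeasure μ]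

/-! ## §1 The block as a closed `P|_{U(2,1)}`-invariant subspace, and its core -/

section Block

variable (ι T hT)
variable (P : DiscreteAutomorphicRep (Gp L H) μ)
  (W : ClosedSubrep (((Gp L H).rightRegular μ).restrict (archToAdelic (↥(maximalRealSubfield L)) L (IsCMField.complexConj L) 3 H)))

/-- **`blockCM ι T hT P W`** — the closed `G′_∞`-block `W ≤ P.space`, read as a closed `P.archRepCM`-invariant subspace of `P.space` (the CM section acts through
`G′_∞`: `cmArchSectionUForm u = archToAdelic (archLift u)`, ★ FILE B). [cite: BorelJacquetCorvallis1979, §4.3 and §4.6] [cite: Dixmier1977, §13.1.2] -/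
def blockCM : ClosedSubrep (P.archRepCM ι T hT) where
  toSubmodule := W.toSubmodule.comap P.space.toSubmodule.subtype
  apply_mem_toSubmodule := fun u v hv => by
    change (((P.archRepCM ι T hT u v : P.space.toSubmodule)) : (Gp L H).L2 μ) ∈ W.toSubmodule
    rw [DiscreteAutomorphicRep.coe_archRep_apply, ← archToAdelic_archLift L ι H T hT u]
    exact W.apply_mem (archLift L ι H T hT u) hv
  isClosed' := W.isClosed.preimage continuous_subtype_val

/-- Membership in `blockCM`: `v ∈ blockCM ↔ ↑v ∈ W`. [cite: Dixmier1977, §13.1.2] -/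
theorem mem_blockCM_iff (v : P.space.toSubmodule) : v ∈ (blockCM ι T hT P W).toSubmodule ↔ (v : (Gp L H).L2 μ) ∈ W.toSubmodule := Iff.rfl

end Block

/-! ## §2 F1a from one admissible block -/

section F1a

variable (ι T hT)
variable (P : DiscreteAutomorphicRep (Gp L H) μ)
  (W : ClosedSubrep (((Gp L H).rightRegular μ).restrict (archToAdelic (↥(maximalRealSubfield L)) L (IsCMField.complexConj L) 3 H)))
  (hW : W.toSubmodule ≤ P.space.toSubmodule)
  {σbar : ContRepresentation ℂ (uFormGroup (Fin 2) (Fin 1)).carrier W.toSubmodule}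
  (hσ : ∀ g, W.toContRep g = σbar (archProjUForm L ι H T hT g))

-- third-level subtype carriers (`L² ⊇ P.space ⊇ archModuleCM ⊇ core`, `L² ⊇ W ⊇ H_K^∞(σbar)`): instance synthesis and `isDefEq` through the coercion layers need
-- head-room (★ `F0P3ArchIsotypyOfIrreducibleCore` USAGE NOTE; measured: the defaults time out)
set_option synthInstance.maxHeartbeats 100000 in
set_option maxHeartbeats 1600000 in
include hσ hW in
/-- **F1a FROM ONE ADMISSIBLE BLOCK.**  If the closed `G′_∞`-block `W ≤ P.space` is topologically irreducible with descent `σbar` along `archProjUForm`, and the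
Harish-Chandra module of `σbar` is `K∞`-admissible, then `P` satisfies F1a at the CM frame: **`P.ArchIsotypy U(2,1) (cmArchSectionUForm L ι H T hT)`**.  The core
`archModuleCM ⊓ W` of `blockCM` is identified with `H_K^∞(σbar)` by the ★ `harishChandraMap`s of the inclusion (`Ψ`) and of the orthogonal projection (`Φ`)
(`Φ ∘ Ψ = id`; `Ψ ∘ Φ = id` on the core); hence it is non-zero, irreducible in submodule language (transport of ★ `isIrreducibleGK_harishChandra_of_isAdmissibleGK`) and
admissible (injective `K`-map `Φ`), and ★ `archIsotypy_of_core'` concludes. [cite: FlathCorvallis1979, Thm. 3 and Thm. 4] [cite: Dixmier1977, §13.1.8]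
[cite: HarishChandra1953, §9 Thms. 4–6] [cite: BorelJacquetCorvallis1979, §4.3 and §4.6] -/
theorem archIsotypy_of_isAdmissibleGK_block (hirr : W.toContRep.IsTopIrreducible)
    (hadm : IsAdmissibleGK (harishChandraRepK (uFormGroup (Fin 2) (Fin 1)) σbar)) :
    P.ArchIsotypy (uFormGroup (Fin 2) (Fin 1)) (cmArchSectionUForm L ι H T hT) := by
  -- unitarity ∕ strong continuity ∕ irreducibility of the descent, and FILE A2
  have hπu : (((Gp L H).rightRegular μ).restrict (archToAdelic (↥(maximalRealSubfield L)) L (IsCMField.complexConj L) 3 H)).IsUnitary :=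
    ((Gp L H).isUnitary_rightRegular μ).restrict _
  have hπc : (((Gp L H).rightRegular μ).restrict (archToAdelic (↥(maximalRealSubfield L)) L (IsCMField.complexConj L) 3 H)).IsStronglyContinuous :=
    ((Gp L H).isStronglyContinuous_rightRegular_holds μ).restrict _ (continuous_archToAdelic (↥(maximalRealSubfield L)) L (IsCMField.complexConj L) 3 H)
  have hWu : W.toContRep.IsUnitary := hπu.toContRep W
  have hWc : W.toContRep.IsStronglyContinuous := fun v => by
    have h1 : Continuous fun g => ((W.toContRep g v : W.toSubmodule) : (Gp L H).L2 μ) := by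
      simp only [ClosedSubrep.coe_toContRep_apply]
      exact hπc (v : (Gp L H).L2 μ)
    exact continuous_induced_rng.2 h1
  have hu : σbar.IsUnitary := isUnitary_of_descend L ι H T hT hσ hWu
  have hc : σbar.IsStronglyContinuous := isStronglyContinuous_of_descend L ι H T hT hσ hWc
  have hirrσ : σbar.IsTopIrreducible := isTopIrreducible_of_descend L ι H T hT hσ hirr
  have hirrM := isIrreducibleGK_harishChandra_of_isAdmissibleGK hu hc hirrσ subgroup_eq_top_of_forall_expMem_mem_uForm hadm
  have hPc : (P.archRepCM ι T hT).IsStronglyContinuous :=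
    P.isStronglyContinuous_archRep (uFormGroup (Fin 2) (Fin 1)) (cmArchSectionUForm L ι H T hT) (continuous_cmArchSectionUForm L ι H T hT)
  -- the two `(𝔤, K)`-maps `Ψ : H_K^∞(σbar) → archModuleCM` (inclusion) and `Φ : archModuleCM → H_K^∞(σbar)` (projection)
  have hT₀ := orthogonalProjection_intertwines (ι := ι) (T := T) (hT := hT) P W hσ
  have hi := inclusion_intertwines (ι := ι) (T := T) (hT := hT) P W hW hσ
  set Ψ := Intertwiner.harishChandraMap (uFormGroup (Fin 2) (Fin 1)) hi with hΨdef
  set Φ := Intertwiner.harishChandraMap (uFormGroup (Fin 2) (Fin 1)) hT₀ with hΦdef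
  set core : Submodule ℂ (P.archModuleCM ι T hT) := (blockCM ι T hT P W).toSubmodule.comap (P.archModuleCM ι T hT).subtype with hcore
  -- (f1) `Φ (Ψ w) = w`
  have f1 : ∀ w : harishChandraSpace (uFormGroup (Fin 2) (Fin 1)) σbar, Φ (Ψ w) = w := fun w => by
    apply Subtype.ext
    have h3 : W.toSubmodule.orthogonalProjectionOnto (((w : W.toSubmodule)) : (Gp L H).L2 μ) = (w : W.toSubmodule) :=
      Submodule.orthogonalProjectionOnto_mem_subspace_eq_self (w : W.toSubmodule)
    rw [hΦdef, hΨdef, Intertwiner.coe_harishChandraMap_apply, Intertwiner.coe_harishChandraMap_apply, ContinuousLinearMap.comp_apply,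
      Submodule.subtypeL_apply]
    exact h3
  -- (f3) `Ψ w ∈ core`
  have f3 : ∀ w : harishChandraSpace (uFormGroup (Fin 2) (Fin 1)) σbar, Ψ w ∈ core := fun w => by
    change ((((Ψ w : P.archModuleCM ι T hT) : P.space.toSubmodule)) : (Gp L H).L2 μ) ∈ W.toSubmodule
    rw [hΨdef, Intertwiner.coe_harishChandraMap_apply]
    exact (w : W.toSubmodule).2
  -- (f2) `Ψ (Φ v) = v` for `v ∈ core` (the projection fixes vectors of `W`)
  have f2 : ∀ v : P.archModuleCM ι T hT, v ∈ core → Ψ (Φ v) = v := fun v hv => by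
    apply Subtype.ext
    apply Subtype.ext
    have hv' : ((v : P.space.toSubmodule) : (Gp L H).L2 μ) ∈ W.toSubmodule := hv
    rw [hΨdef, hΦdef, Intertwiner.coe_harishChandraMap_apply]
    change ((((W.toSubmodule.orthogonalProjectionOnto.comp P.space.toSubmodule.subtypeL) (v : P.space.toSubmodule) : W.toSubmodule)) : (Gp L H).L2 μ) =
      ((v : P.space.toSubmodule) : (Gp L H).L2 μ)
    rw [ContinuousLinearMap.comp_apply, Submodule.subtypeL_apply, Submodule.coe_orthogonalProjectionOnto_apply]
    exact Submodule.starProjection_eq_self_iff.mpr hv'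
  -- the core is non-zero
  haveI := hirrM.nontrivial
  have hne : core ≠ ⊥ := by
    obtain ⟨w, hw⟩ := exists_ne (0 : harishChandraSpace (uFormGroup (Fin 2) (Fin 1)) σbar)
    intro hbot
    have h1 : Ψ w = 0 := (Submodule.mem_bot ℂ).mp (hbot ▸ f3 w)
    apply hw
    rw [← f1 w, h1, map_zero]
  -- irreducibility of the core in submodule language (transport of `hirrM` along `Ψ`, `Φ`)
  have hirr' : ∀ U : Submodule ℂ (P.archModuleCM ι T hT), IsGKSubmodule (P.archRepKCM ι T hT) (P.archRepLieCM ι T hT) U → U ≤ core →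
      U = ⊥ ∨ U = core := by
    intro U hU hUle
    have hU' : IsGKSubmodule (harishChandraRepK (uFormGroup (Fin 2) (Fin 1)) σbar) (harishChandraRepLie (uFormGroup (Fin 2) (Fin 1)) σbar hc)
        (U.comap Ψ) := by
      refine ⟨fun k w hw => ?_, fun X w hw => ?_⟩
      · change Ψ (harishChandraRepK (uFormGroup (Fin 2) (Fin 1)) σbar k w) ∈ U
        rw [hΨdef, Intertwiner.harishChandraMap_repK]
        exact hU.1 k _ hw
      · change Ψ (harishChandraRepLie (uFormGroup (Fin 2) (Fin 1)) σbar hc X w) ∈ U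
        rw [hΨdef, Intertwiner.harishChandraMap_repLie (uFormGroup (Fin 2) (Fin 1)) hi hc hPc]
        exact hU.2 X _ hw
    rcases hirrM.2 (U.comap Ψ) hU' with hbot | htop
    · left
      rw [Submodule.eq_bot_iff]
      intro u hu'
      have h1 : Φ u ∈ U.comap Ψ := by
        change Ψ (Φ u) ∈ U
        rw [f2 u (hUle hu')]
        exact hu'
      rw [hbot, Submodule.mem_bot] at h1
      rw [← f2 u (hUle hu'), h1, map_zero]
      rfl
    · right
      refine le_antisymm hUle fun v hv => ?_
      have h1 : Φ v ∈ U.comap Ψ := by rw [htop]; exact Submodule.mem_top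
      rw [← f2 v hv]
      exact h1
  -- admissibility of the core: `Φ` restricted to the core is an injective `K`-map into the admissible `H_K^∞(σbar)`
  have hadm' : IsAdmissibleGK (V := ↥core)
      ((P.archRepKCM ι T hT).subrepresentation core (core_le_comap_archRepK P _ _ (blockCM ι T hT P W))) := by
    intro V _ _ _ τ hτ
    haveI := hadm V τ hτ
    let j : ((P.archRepKCM ι T hT).subrepresentation core (core_le_comap_archRepK P _ _ (blockCM ι T hT P W))).IntertwiningMap
        (harishChandraRepK (uFormGroup (Fin 2) (Fin 1)) σbar) :=
      { toLinearMap := Φ ∘ₗ core.subtype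
        isIntertwining' := fun k => LinearMap.ext fun v => by
          change Φ (P.archRepKCM ι T hT k (v : P.archModuleCM ι T hT)) =
            harishChandraRepK (uFormGroup (Fin 2) (Fin 1)) σbar k (Φ (v : P.archModuleCM ι T hT))
          rw [hΦdef]
          exact Intertwiner.harishChandraMap_repK (uFormGroup (Fin 2) (Fin 1)) hT₀ k _ }
    have hjinj : Function.Injective j := fun v w hvw => by
      apply Subtype.ext
      have h1 : Φ (v : P.archModuleCM ι T hT) = Φ (w : P.archModuleCM ι T hT) := hvw
      rw [← f2 _ v.2, ← f2 _ w.2, h1]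
    refine Module.Finite.of_injective (Representation.IntertwiningMap.llcomp τ _ _ j) fun S₁ S₂ hS => ?_
    refine Representation.IntertwiningMap.ext (LinearMap.ext fun w => hjinj ?_)
    exact congrArg (fun S : τ.IntertwiningMap (harishChandraRepK (uFormGroup (Fin 2) (Fin 1)) σbar) => S w) hS
  -- `ArchIsotypy` is a `∀` over its standing hypotheses: introduce them and hand them to ★ HEAD 3
  intro _ _ _ hA hG hι' hfac
  exact archIsotypy_of_core' P (uFormGroup (Fin 2) (Fin 1)) (cmArchSectionUForm L ι H T hT) (continuous_cmArchSectionUForm L ι H T hT)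
    (blockCM ι T hT P W) hne hirr' hadm' hA hG hι' hfac

end F1a

/-! ## §3 L-iso with no letter antecedent -/

section Liso

variable (L ι H T hT)

/-- **THE CLASS OF AN ADMISSIBLE ARCHIMEDEAN BLOCK IS THE TOKEN OF RECORD — NO LETTER.**  FILE B's ★ `isUnitaryGlobalization_clInfChoiceU_of_archIsotypy` with its F1a
antecedent discharged by `archIsotypy_of_isAdmissibleGK_block` (the SAME block `W` supplies F1a for `P`): for `W ≤ P.space` a closed topologically irreducible
`G′_∞`-block with descent `σbar` and `K∞`-admissible Harish-Chandra module, `IsUnitaryGlobalization U(2,1) (clInfChoiceU L H ι T hT μ dflt P) σbar`.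
[cite: HarishChandra1953, §9 Thms. 4–6 and Thm. 8] [cite: FlathCorvallis1979, Thm. 3 and Thm. 4] [cite: Dixmier1977, §13.1.8] -/
theorem isUnitaryGlobalization_clInfChoiceU_of_isAdmissibleGK (dflt : Cinf) (P : DiscreteAutomorphicRep (Gp L H) μ)
    (W : ClosedSubrep (((Gp L H).rightRegular μ).restrict (archToAdelic (↥(maximalRealSubfield L)) L (IsCMField.complexConj L) 3 H)))
    (hW : W.toSubmodule ≤ P.space.toSubmodule) (hirr : W.toContRep.IsTopIrreducible)
    (σbar : ContRepresentation ℂ (uFormGroup (Fin 2) (Fin 1)).carrier W.toSubmodule) (hσ : ∀ g, W.toContRep g = σbar (archProjUForm L ι H T hT g))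
    (hadm : IsAdmissibleGK (harishChandraRepK (uFormGroup (Fin 2) (Fin 1)) σbar)) :
    IsUnitaryGlobalization (uFormGroup (Fin 2) (Fin 1)) (clInfChoiceU L H ι T hT μ dflt P) σbar :=
  isUnitaryGlobalization_clInfChoiceU_of_archIsotypy L ι H T hT dflt P (archIsotypy_of_isAdmissibleGK_block ι T hT P W hW hσ hirr hadm) W hW hirr σbar hσ hadm

/-- **L-iso♭ WITH NO LETTER** — the `hiso` binder of ★ p839537 `h3_of_core_of_adm_of_iso` at the class `c`, with the SINGLE added antecedent
`IsAdmissibleGK (harishChandraRepK U(2,1) σbar)` (and its unused `cptTriv₀ c` dropped): every closed topologically irreducible `G′_∞`-block `W ≤ rep c` with `K∞`-admissible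
Harish-Chandra module is, under any descent `σbar` along `archProjUForm`, a unitary globalization of `clInfChoiceU … (rep c)`. [cite: Dixmier1977, §13.1.8]
[cite: FlathCorvallis1979, Thm. 3 and Thm. 4] [cite: HarishChandra1953, §9 Thms. 4–6 and Thm. 8] -/
theorem liso_of_isAdmissibleGK (dflt : Cinf) (c : Cls (Gp L H) μ)
    (W : ClosedSubrep (((Gp L H).rightRegular μ).restrict (archToAdelic (↥(maximalRealSubfield L)) L (IsCMField.complexConj L) 3 H)))
    (hW : W.toSubmodule ≤ (rep (Gp L H) μ c).space.toSubmodule) (hirr : W.toContRep.IsTopIrreducible)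
    (σbar : ContRepresentation ℂ (uFormGroup (Fin 2) (Fin 1)).carrier W.toSubmodule) (hσ : ∀ g, W.toContRep g = σbar (archProjUForm L ι H T hT g))
    (hadm : IsAdmissibleGK (harishChandraRepK (uFormGroup (Fin 2) (Fin 1)) σbar)) :
    IsUnitaryGlobalization (uFormGroup (Fin 2) (Fin 1)) (clInfChoiceU L H ι T hT μ dflt (rep (Gp L H) μ c)) σbar :=
  isUnitaryGlobalization_clInfChoiceU_of_isAdmissibleGK L ι H T hT dflt (rep (Gp L H) μ c) W hW hirr σbar hσ hadm

end Liso

end Summit.HodgeConjecture.HodgeConjecture.Cruxes.H413.F0P3ArchIsotypyOfAdmissibleBlock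

end
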